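import Summits.HubbardSuperconductivity.HubbardSuperconductivity.Theorems.ThermalWedgeTwApproximatingHamiltonian
import Summits.HubbardSuperconductivity.HubbardSuperconductivity.Theorems.ThermalWedgeTwSeededEnsembleEquivalenceRTrialMoments
import Summits.HubbardSuperconductivity.HubbardSuperconductivity.Theorems.ThermalWedgeTwSeededEnsembleEquivalenceRBlockDensityCalculus
import Summits.HubbardSuperconductivity.HubbardSuperconductivity.Theorems.ThermalWedgeTwSeededEnsembleEquivalenceRBlockPressureLimit
import Summits.HubbardSuperconductivity.HubbardSuperconductivity.Theorems.ThermalWedgeTwSeededEnsembleEquivalenceRSourcedPressureBasics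
import Summits.HubbardSuperconductivity.HubbardSuperconductivity.Theorems.ThermalWedgeTwSeededEnsembleEquivalenceSeededLimitOfSourcedLimit
import Literature.MathematicalPhysics.QuantumLattice.RegionalNumberCharge
import Summits.HubbardSuperconductivity.HubbardSuperconductivity.Theorems.ThermalWedgeTwSeededEnsembleEquivalenceRTwoPhaseBudgetArithmetic

/-!
# Crux `TwSeededEnsembleEquivalenceR` (stmt-HubbardSuperconductivity-15581), line `cold-floor-collapse` (slug `Sketch`),
# skeleton v8 (block two-phase pinning) — registered stub `stub_trialStateBudget` (S7i)

Support file (`--supports stmt-HubbardSuperconductivity-15581`; sorry-free; no definition).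
The finite-volume two-phase bound at fixed (β,U,g,μ*,h₀) (lead); S7b → S7c → core.
-/

set_option linter.dupNamespace false

namespace Summit.HubbardSuperconductivity.HubbardSuperconductivity.Theorems.TwSeededEnsembleEquivalenceR.ColdFloorLine

open Matrix Filter Topology Finset Literature.MathematicalPhysics.QuantumLattice
open Literature.Barriers.HubbardSuperconductivity Literature.Probability.LatticeModels
open Summit.HubbardSuperconductivity.HubbardSuperconductivity.Theorems.TwSeededEnsembleEquivalence.ThermalDuality
open scoped ComplexOrder Matrix.Norms.L2Operator

noncomputable section

set_option maxHeartbeats 1600000 in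
/-- **S7i `stub_trialStateBudget` (lead; the two-phase trial state and its budget).** Under the hypotheses of S7d (an interior `μs`,
a maximiser `h₀` of `h ↦ q(μs,h) − h²/g` carrying the subgradient `1 − δ` of `q(·,h₀)` on the window, `q` the sourced limit
pressure at `β`): for every `ε > 0`, eventually in `L`, there is a Hermitian trial `K̃` on the torus Fock space (S7c's product of
sourced `M × M` blocks at `μs ∓ σ` with the common source `h₀`, block count tuned) whose Peierls–Bogoliubov gap
`A = log Re Z_β(K) − log Re Z_β(K̃) + β Re⟨K − K̃⟩_{K̃}` is `≤ βεL²` (AHM 1703 via `tw_seededPressureLimit_of_sourcedLimit`, S7b block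
pressures, S7f chords: the Bregman terms are second differences of the 2-Lipschitz `q(·,h₀)` over steps `σ`, `≤ 4σ`) and whose number
fluctuation about `N_L = 2⌊(1−δ)L²/2⌋` is `≤ εL⁴` (S7c (ii) + block-count tuning through the subgradient: left chords `≤ 1 − δ ≤` right
chords, S7f). [folklore composition] -/
theorem stub_trialStateBudget :
    ∀ (β U g δ μ₁ μ₂ μs h₀ : ℝ), 0 < β → 0 ≤ U → 0 < g → δ ∈ Set.Icc (1/10 : ℝ) (2/5 : ℝ) → μ₁ < μs → μs < μ₂ →
      h₀ ∈ Set.Icc (-(13 * g + 1)) (13 * g + 1) → ∀ q : ℝ → ℝ → ℝ,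
      (∀ μ ∈ Set.Icc μ₁ μ₂, ∀ h ∈ Set.Icc (-(13 * g + 1)) (13 * g + 1), ∀ κ : ℝ, 0 < κ →
        ∃ L₀ : ℕ, ∀ (L : ℕ) [NeZero L], L₀ ≤ L →
          |Real.log (Matrix.partitionFn β (dWaveSourceTorus L U μ h)).re / (β * (L : ℝ) ^ 2) - q μ h| ≤ κ) →
      q μs h₀ - h₀ ^ 2 / g = sSup ((fun h' : ℝ => q μs h' - h' ^ 2 / g) '' Set.Icc (-(13 * g + 1)) (13 * g + 1)) →
      (∀ μ' ∈ Set.Icc μ₁ μ₂, q μs h₀ + (1 - δ) * (μ' - μs) ≤ q μ' h₀) →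
      ∀ ε : ℝ, 0 < ε → ∃ L₀ : ℕ, ∀ (L : ℕ) [NeZero L], L₀ ≤ L →
        ∃ Kt : Matrix (Finset (Orb (FermionTorus 2 L))) (Finset (Orb (FermionTorus 2 L))) ℂ, Kt.IsHermitian ∧
          Real.log (Matrix.partitionFn β (hubbardTorusWith 2 L 1 U μs - ((g / (L : ℝ) ^ 2 : ℝ) : ℂ) • ((pairField dWaveFormFactor L)ᴴ * pairField dWaveFormFactor L))).re - Real.log (Matrix.partitionFn β Kt).re +
              β * (Matrix.gibbsState β Kt ((hubbardTorusWith 2 L 1 U μs - ((g / (L : ℝ) ^ 2 : ℝ) : ℂ) • ((pairField dWaveFormFactor L)ᴴ * pairField dWaveFormFactor L)) - Kt)).re ≤ β * ε * (L : ℝ) ^ 2 ∧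
          (Matrix.gibbsState β Kt (((totalNumber : Matrix (Finset (Orb (FermionTorus 2 L))) (Finset (Orb (FermionTorus 2 L))) ℂ) - (((2 * ⌊(1 - δ) * (L : ℝ) ^ 2 / 2⌋₊ : ℕ) : ℝ) : ℂ) • (1 : Matrix (Finset (Orb (FermionTorus 2 L))) (Finset (Orb (FermionTorus 2 L))) ℂ)) * ((totalNumber : Matrix (Finset (Orb (FermionTorus 2 L))) (Finset (Orb (FermionTorus 2 L))) ℂ) - (((2 * ⌊(1 - δ) * (L : ℝ) ^ 2 / 2⌋₊ : ℕ) : ℝ) : ℂ) • (1 : Matrix (Finset (Orb (FermionTorus 2 L))) (Finset (Orb (FermionTorus 2 L))) ℂ)))).re ≤ ε * (L : ℝ) ^ 4 := by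
  intro β U g δ μ₁ μ₂ μs h₀ hβ hU hg hδ hμ1 hμ2 hh₀ q hq hmax hsub ε hε
  -- Step 0: the small parameters `ε' ≤ 1`, `σ`, `r`
  obtain ⟨ε', hε'0, hε'ε, hε'1⟩ : ∃ ε' : ℝ, 0 < ε' ∧ ε' ≤ ε ∧ ε' ≤ 1 :=
    ⟨min ε 1, lt_min hε one_pos, min_le_left _ _, min_le_right _ _⟩
  obtain ⟨σ, hσ0, hσε, hσ1, hσ2⟩ : ∃ σ : ℝ, 0 < σ ∧ σ ≤ ε' / 64 ∧ 2 * σ ≤ μs - μ₁ ∧ 2 * σ ≤ μ₂ - μs := by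
    refine ⟨min (ε' / 64) (min ((μs - μ₁) / 2) ((μ₂ - μs) / 2)),
      lt_min (by positivity) (lt_min (by linarith) (by linarith)), min_le_left _ _, ?_, ?_⟩
    · have h1 := min_le_right (ε' / 64) (min ((μs - μ₁) / 2) ((μ₂ - μs) / 2))
      have h2 := min_le_left ((μs - μ₁) / 2) ((μ₂ - μs) / 2)
      linarith
    · have h1 := min_le_right (ε' / 64) (min ((μs - μ₁) / 2) ((μ₂ - μs) / 2))
      have h2 := min_le_right ((μs - μ₁) / 2) ((μ₂ - μs) / 2)
      linarith
  obtain ⟨r, hr0, hrε, hrσ⟩ : ∃ r : ℝ, 0 < r ∧ r ≤ ε' / 64 ∧ 4 * r / σ ≤ ε' / 8 := by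
    refine ⟨min (ε' / 64) (σ * ε' / 32), lt_min (by positivity) (by positivity), min_le_left _ _, ?_⟩
    have h1 := min_le_right (ε' / 64) (σ * ε' / 32)
    rw [div_le_iff₀ hσ0]
    linarith
  have hμsW : μs ∈ Set.Icc μ₁ μ₂ := ⟨hμ1.le, hμ2.le⟩
  have hm2W : μs - σ - σ ∈ Set.Icc μ₁ μ₂ := ⟨by linarith, by linarith⟩
  have hm1W : μs - σ ∈ Set.Icc μ₁ μ₂ := ⟨by linarith, by linarith⟩
  have hp1W : μs + σ ∈ Set.Icc μ₁ μ₂ := ⟨by linarith, by linarith⟩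
  have hp2W : μs + σ + σ ∈ Set.Icc μ₁ μ₂ := ⟨by linarith, by linarith⟩
  -- Step 1: `φ = q(·,h₀)` is `2`-Lipschitz on the window (inherited from finite volume)
  have hseq : ∀ μ ∈ Set.Icc μ₁ μ₂, ∀ κ' : ℝ, 0 < κ' → ∃ N : ℕ, ∀ n, N ≤ n →
      |Real.log (partitionFn β (dWaveSourceTorus (n + 1) U μ h₀)).re / (β * (((n + 1 : ℕ) : ℝ)) ^ 2) - q μ h₀| ≤ κ' := by
    intro μ hμ κ' hκ'
    obtain ⟨L₀, hL₀⟩ := hq μ hμ h₀ hh₀ κ' hκ'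
    exact ⟨L₀, fun n hn => hL₀ (n + 1) (by omega)⟩
  have hLip : ∀ μ ∈ Set.Icc μ₁ μ₂, ∀ μ' ∈ Set.Icc μ₁ μ₂, |q μ h₀ - q μ' h₀| ≤ 2 * |μ - μ'| := by
    intro μ hμ μ' hμ'
    refine cfb_abs_sub_le_of_limits (hseq μ hμ) (hseq μ' hμ') fun n => ?_
    have := cfb_abs_sourcedPressure_sub_mu_le (n + 1) U h₀ hβ μ μ'
    simpa using this
  have h1 : |q μs h₀ - q (μs - σ) h₀| ≤ 2 * σ := by
    have := hLip μs hμsW (μs - σ) hm1W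
    rwa [show μs - (μs - σ) = σ by ring, abs_of_pos hσ0] at this
  have h2 : |q (μs - σ) h₀ - q (μs - σ - σ) h₀| ≤ 2 * σ := by
    have := hLip (μs - σ) hm1W (μs - σ - σ) hm2W
    rwa [show μs - σ - (μs - σ - σ) = σ by ring, abs_of_pos hσ0] at this
  have h3 : |q (μs + σ) h₀ - q μs h₀| ≤ 2 * σ := by
    have := hLip (μs + σ) hp1W μs hμsW
    rwa [show μs + σ - μs = σ by ring, abs_of_pos hσ0] at this
  have h4 : |q (μs + σ + σ) h₀ - q (μs + σ) h₀| ≤ 2 * σ := by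
    have := hLip (μs + σ + σ) hp2W (μs + σ) hp1W
    rwa [show μs + σ + σ - (μs + σ) = σ by ring, abs_of_pos hσ0] at this
  -- Step 2: the constant of S7c and the block accuracy (S7b, identified with `q` by uniqueness of the torus limit)
  obtain ⟨C, hC0, hS7c⟩ := stub_trialMoments
  have hblock : ∀ μ ∈ Set.Icc μ₁ μ₂, ∀ κ' : ℝ, 0 < κ' → ∃ M₀ : ℕ, ∀ (M : ℕ), M₀ ≤ M →
      |Real.log (Matrix.partitionFn β (hamiltonianWith ((zdGraph 2).comap (fun p : (Lex (Fin M × Fin M)) => ![((ofLex p).1 : ℤ), ((ofLex p).2 : ℤ)])) 1 U μ - (h₀ : ℂ) • ((∑ z : (Lex (Fin M × Fin M)) × (Lex (Fin M × Fin M)), (fun z : (Lex (Fin M × Fin M)) × (Lex (Fin M × Fin M)) => (fun v : Fin 2 → ℤ => ((dWaveFormFactor v / Real.sqrt 2 : ℝ) : ℂ)) (![((ofLex z.2).1 : ℤ), ((ofLex z.2).2 : ℤ)] - ![((ofLex z.1).1 : ℤ), ((ofLex z.1).2 : ℤ)])) z • bondPair z.1 z.2) + (∑ z : (Lex (Fin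 M × Fin M)) × (Lex (Fin M × Fin M)), (fun z : (Lex (Fin M × Fin M)) × (Lex (Fin M × Fin M)) => (fun v : Fin 2 → ℤ => ((dWaveFormFactor v / Real.sqrt 2 : ℝ) : ℂ)) (![((ofLex z.2).1 : ℤ), ((ofLex z.2).2 : ℤ)] - ![((ofLex z.1).1 : ℤ), ((ofLex z.1).2 : ℤ)])) z • bondPair z.1 z.2)ᴴ))).re / (β * (M : ℝ) ^ 2) - q μ h₀| ≤ κ' := by
    intro μ hμ κ' hκ'
    obtain ⟨qb, hqt, hqb⟩ := stub_blockPressureLimit β U μ h₀ hβ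
    have hqq : qb = q μ h₀ := by
      by_contra hne
      have hpos : 0 < |qb - q μ h₀| / 4 := by
        have : 0 < |qb - q μ h₀| := abs_pos.mpr (sub_ne_zero.mpr hne)
        positivity
      obtain ⟨L₁, hL₁⟩ := hqt _ hpos
      obtain ⟨L₂, hL₂⟩ := hq μ hμ h₀ hh₀ _ hpos
      have e1 := hL₁ (max L₁ L₂ + 1) (by omega)
      have e2 := hL₂ (max L₁ L₂ + 1) (by omega)
      have e3 := abs_sub_le qb (Real.log (Matrix.partitionFn β (dWaveSourceTorus (max L₁ L₂ + 1) U μ h₀)).re /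
        (β * ((max L₁ L₂ + 1 : ℕ) : ℝ) ^ 2)) (q μ h₀)
      rw [abs_sub_comm] at e1
      linarith [abs_nonneg (qb - q μ h₀)]
    subst hqq
    exact hqb κ' hκ'
  obtain ⟨Ma, hMa⟩ := hblock _ hm2W r hr0
  obtain ⟨Mb, hMb⟩ := hblock _ hm1W r hr0
  obtain ⟨Mc, hMc⟩ := hblock _ hμsW r hr0
  obtain ⟨Md, hMd⟩ := hblock _ hp1W r hr0
  obtain ⟨Me, hMe⟩ := hblock _ hp2W r hr0
  -- Step 3: the block size `M`
  have hC₁ : 0 ≤ C * (1 + |h₀|) := by positivity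
  obtain ⟨M, hM1, ⟨hMa', hMb', hMc', hMd', hMe'⟩, hMcut⟩ : ∃ M : ℕ, 1 ≤ M ∧ (Ma ≤ M ∧ Mb ≤ M ∧ Mc ≤ M ∧ Md ≤ M ∧ Me ≤ M) ∧
      C * (1 + |h₀|) / M ≤ ε' / 64 := by
    refine ⟨max (max 1 ⌈64 * (C * (1 + |h₀|)) / ε'⌉₊) (max (max Ma Mb) (max Mc (max Md Me))), ?_, ⟨?_, ?_, ?_, ?_, ?_⟩, ?_⟩
    · exact le_trans (le_max_left _ _) (le_max_left _ _)
    · exact le_trans (le_trans (le_max_left _ _) (le_max_left _ _)) (le_max_right _ _)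
    · exact le_trans (le_trans (le_max_right _ _) (le_max_left _ _)) (le_max_right _ _)
    · exact le_trans (le_trans (le_max_left _ _) (le_max_right _ _)) (le_max_right _ _)
    · exact le_trans (le_trans (le_trans (le_max_left _ _) (le_max_right _ _)) (le_max_right _ _)) (le_max_right _ _)
    · exact le_trans (le_trans (le_trans (le_max_right _ _) (le_max_right _ _)) (le_max_right _ _)) (le_max_right _ _)
    · set Mx : ℕ := max (max 1 ⌈64 * (C * (1 + |h₀|)) / ε'⌉₊) (max (max Ma Mb) (max Mc (max Md Me))) with hMx
      have hceil : (⌈64 * (C * (1 + |h₀|)) / ε'⌉₊ : ℝ) ≤ Mx := by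
        exact_mod_cast le_trans (le_max_right _ _) (le_max_left _ _)
      have hMxpos : (0 : ℝ) < Mx := by
        have : (1 : ℕ) ≤ Mx := le_trans (le_max_left _ _) (le_max_left _ _)
        exact_mod_cast Nat.lt_of_lt_of_le Nat.zero_lt_one this
      have hle : 64 * (C * (1 + |h₀|)) / ε' ≤ Mx := (Nat.le_ceil _).trans hceil
      rw [div_le_iff₀ hMxpos]
      rw [div_le_iff₀ hε'0] at hle
      linarith
  have hMr1 : (1 : ℝ) ≤ M := by exact_mod_cast hM1
  have hMpos : (0 : ℝ) < M := by positivity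
  -- Step 4: the seeded pressure at `μs` (AHM 1703 + the sourced limit)
  obtain ⟨L₁, hL₁⟩ := tw_seededPressureLimit_of_sourcedLimit U g β μs (q μs) hβ hg
      (twApproximatingHamiltonian_proof U μs β g hβ hg) (fun h hh => hq μs hμsW h hh) (ε' / 64) (by positivity)
  -- Step 5: thresholds for the `O(LM)` and `O(L²M²)` terms
  have hc₃ : 0 ≤ 2 * |q μs h₀| + C * (1 + |h₀|) := by positivity
  have hc₄ : 0 ≤ C * (1 + β * (U + |μs|)) := by
    have : 0 ≤ U + |μs| := by positivity
    positivity
  set L₂ : ℕ := ⌈M * (β * (2 * |q μs h₀| + C * (1 + |h₀|)) + C * (1 + β * (U + |μs|))) / (β * (ε' / 2))⌉₊ with hL₂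
  set L₃ : ℕ := ⌈(1728 + C * (1 + Real.sqrt (β * |h₀|))) * (M : ℝ) ^ 2 / (13 / 16 * ε')⌉₊ with hL₃
  refine ⟨max (max L₁ M) (max L₂ L₃), fun L _ hL => ?_⟩
  have hLL₁ : L₁ ≤ L := le_trans (le_trans (le_max_left _ _) (le_max_left _ _)) hL
  have hML : M ≤ L := le_trans (le_trans (le_max_right _ _) (le_max_left _ _)) hL
  have hL₂L : L₂ ≤ L := le_trans (le_trans (le_max_left _ _) (le_max_right _ _)) hL
  have hL₃L : L₃ ≤ L := le_trans (le_trans (le_max_right _ _) (le_max_right _ _)) hL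
  have hMLr : (M : ℝ) ≤ L := by exact_mod_cast hML
  have hLr1 : (1 : ℝ) ≤ L := hMr1.trans hMLr
  have hLpos : (0 : ℝ) < L := by positivity
  have hthr₂ : (M : ℝ) * (β * (2 * |q μs h₀| + C * (1 + |h₀|)) + C * (1 + β * (U + |μs|))) ≤ β * (ε' / 2) * L := by
    have hden : 0 < β * (ε' / 2) := by positivity
    have h := (Nat.le_ceil _).trans (show (L₂ : ℝ) ≤ L by exact_mod_cast hL₂L)
    rw [div_le_iff₀ hden] at h
    linarith
  have hthr₃ : (1728 + C * (1 + Real.sqrt (β * |h₀|))) * (M : ℝ) ^ 2 ≤ 13 / 16 * ε' * L := by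
    have hden : 0 < 13 / 16 * ε' := by positivity
    have h := (Nat.le_ceil _).trans (show (L₃ : ℝ) ≤ L by exact_mod_cast hL₃L)
    rw [div_le_iff₀ hden] at h
    linarith
  -- Step 6: block counts `K = ⌊L/M⌋²`
  have hKMn : ((L / M : ℕ) : ℝ) * M ≤ L := by exact_mod_cast Nat.div_mul_le_self L M
  have hKM : (((L / M) ^ 2 : ℕ) : ℝ) * (M : ℝ) ^ 2 ≤ (L : ℝ) ^ 2 := by
    push_cast
    rw [← mul_pow]
    exact pow_le_pow_left₀ (mul_nonneg (Nat.cast_nonneg _) hMpos.le) hKMn 2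
  have hLK : (L : ℝ) ^ 2 - (((L / M) ^ 2 : ℕ) : ℝ) * (M : ℝ) ^ 2 ≤ 2 * L * M := by
    have hlt : (L : ℝ) < ((L / M : ℕ) : ℝ) * M + M := by exact_mod_cast Nat.lt_div_mul_add (by omega : 0 < M)
    push_cast
    nlinarith [hKMn, hlt, hMpos, Nat.cast_nonneg (α := ℝ) (L / M)]
  have hKr0 : (0 : ℝ) ≤ (((L / M) ^ 2 : ℕ) : ℝ) := Nat.cast_nonneg _
  -- Step 7: the block densities and chords (S7f) and the accuracies at `M`
  obtain ⟨hdens, hchord, -⟩ := stub_blockDensityCalculus M hM1 β U h₀ hβ hU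
  have cA := hchord (μs - σ) σ hσ0.le
  have cS := hchord μs σ hσ0.le
  have cB := hchord (μs + σ) σ hσ0.le
  rw [show μs - σ + σ = μs from sub_add_cancel μs σ] at cA
  rw [show μs + σ - σ = μs from add_sub_cancel_right μs σ] at cB
  have aAm := hMa M hMa'
  have aA := hMb M hMb'
  have aS := hMc M hMc'
  have aB := hMd M hMd'
  have aBp := hMe M hMe'
  obtain ⟨hAB, hnA, hnB⟩ := tsb_block_arith (μs := μs) hβ hMpos hσ0 aS aA aB cA.1 cS.2 cS.1 cB.2
    (hsub _ hm1W) (hsub _ hp1W)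
  have hnA0 := (hdens (μs - σ)).1
  have hnB2 := (hdens (μs + σ)).2
  -- Step 8: the target sector `N_L`
  have hδ0 : 0 ≤ 1 - δ := by linarith [hδ.2]
  have hδ1 : 1 - δ ≤ 1 := by linarith [hδ.1]
  have hNL1 : (1 - δ) * (L : ℝ) ^ 2 - 2 ≤ ((2 * ⌊(1 - δ) * (L : ℝ) ^ 2 / 2⌋₊ : ℕ) : ℝ) := by
    push_cast
    have := Nat.lt_floor_add_one ((1 - δ) * (L : ℝ) ^ 2 / 2)
    linarith
  have hNL2 : ((2 * ⌊(1 - δ) * (L : ℝ) ^ 2 / 2⌋₊ : ℕ) : ℝ) ≤ (1 - δ) * (L : ℝ) ^ 2 := by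
    push_cast
    have := Nat.floor_le (div_nonneg (mul_nonneg hδ0 (sq_nonneg (L : ℝ))) zero_le_two)
    linarith
  -- Step 9: tune the block count and build the trial state (S7c)
  obtain ⟨a, haK, htune⟩ := tsb_tuning ((L / M) ^ 2) (((2 * ⌊(1 - δ) * (L : ℝ) ^ 2 / 2⌋₊ : ℕ) : ℝ) - 3 * L * M) hAB
  obtain ⟨SA, SB, SR, T₀, hdAB, hdAR, hdBR, hcov, hSR, hT₀, -, -, hsep, hener, hmom, hvar⟩ :=
    hS7c L M hM1 hML a haK U μs h₀ hU
  obtain ⟨R, hRb, hlogZ⟩ := hsep β hβ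
  have hE := hener β hβ g hg (μs - σ) (μs + σ)
  obtain ⟨hmA, hmB⟩ := hmom β hβ (μs - σ) (μs + σ)
  have hV := hvar β hβ (μs - σ) (μs + σ) (((2 * ⌊(1 - δ) * (L : ℝ) ^ 2 / 2⌋₊ : ℕ) : ℝ))
  have hZt := hlogZ (μs - σ) (μs + σ)
  have hcast : (((L / M) ^ 2 - a : ℕ) : ℝ) = (((L / M) ^ 2 : ℕ) : ℝ) - (a : ℝ) := Nat.cast_sub haK
  rw [hcast] at hZt hmB
  have haKr : (a : ℝ) ≤ (((L / M) ^ 2 : ℕ) : ℝ) := by exact_mod_cast haK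
  have hHerm : (T₀ - ((μs - σ : ℝ) : ℂ) • (Matrix.diagonal fun s : Finset (Orb (FermionTorus 2 L)) => (((s ∩ SA).card : ℕ) : ℂ)) - ((μs + σ : ℝ) : ℂ) • (Matrix.diagonal fun s : Finset (Orb (FermionTorus 2 L)) => (((s ∩ SB).card : ℕ) : ℂ)) - (μs : ℂ) • (Matrix.diagonal fun s : Finset (Orb (FermionTorus 2 L)) => (((s ∩ SR).card : ℕ) : ℂ))).IsHermitian :=
    isHermitian_sub_smul (isHermitian_sub_smul (isHermitian_sub_smul hT₀ (isHermitian_numberDiag SA) _)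
      (isHermitian_numberDiag SB) _) (isHermitian_numberDiag SR) μs
  refine ⟨_, hHerm, ?_, ?_⟩
  · -- THE GAP
    have hZK : Real.log (Matrix.partitionFn β (hubbardTorusWith 2 L 1 U μs - ((g / (L : ℝ) ^ 2 : ℝ) : ℂ) • ((pairField dWaveFormFactor L)ᴴ * pairField dWaveFormFactor L))).re / (β * (L : ℝ) ^ 2) - (q μs h₀ - h₀ ^ 2 / g) ≤ ε' / 64 := by
      have := hL₁ L hLL₁
      rw [← hmax] at this
      exact (abs_le.mp this).2
    have hgap := tsb_gap_arith hβ hLpos hMpos (Nat.cast_nonneg a) haKr hKM hLK hr0.le h1 h2 h3 h4 hZK aA aAm aB aBp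
      cA.2 cB.1 hZt hRb hmA hmB hE
    have hfin := tsb_gap_final hβ hLpos.le hε'0.le hgap hσε le_rfl hrε hMcut le_rfl hthr₂
    calc _ ≤ β * ε' * (L : ℝ) ^ 2 := hfin
      _ ≤ β * ε * (L : ℝ) ^ 2 := by gcongr
  · -- THE FLUCTUATION
    have hN : (totalNumber : Matrix (Finset (Orb (FermionTorus 2 L))) (Finset (Orb (FermionTorus 2 L))) ℂ) = (Matrix.diagonal fun s : Finset (Orb (FermionTorus 2 L)) => (((s ∩ SA).card : ℕ) : ℂ)) + (Matrix.diagonal fun s : Finset (Orb (FermionTorus 2 L)) => (((s ∩ SB).card : ℕ) : ℂ)) + (Matrix.diagonal fun s : Finset (Orb (FermionTorus 2 L)) => (((s ∩ SR).card : ℕ) : ℂ)) := by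
      rw [totalNumber_eq_numberDiag_univ (Λ := FermionTorus 2 L), orbs_univ, ← hcov,
        numberDiag_union (Finset.disjoint_union_left.2 ⟨hdAR, hdBR⟩), numberDiag_union hdAB]
    have hX : (Matrix.gibbsState β (T₀ - ((μs - σ : ℝ) : ℂ) • (Matrix.diagonal fun s : Finset (Orb (FermionTorus 2 L)) => (((s ∩ SA).card : ℕ) : ℂ)) - ((μs + σ : ℝ) : ℂ) • (Matrix.diagonal fun s : Finset (Orb (FermionTorus 2 L)) => (((s ∩ SB).card : ℕ) : ℂ)) - (μs : ℂ) • (Matrix.diagonal fun s : Finset (Orb (FermionTorus 2 L)) => (((s ∩ SR).card : ℕ) : ℂ))) (totalNumber : Matrix (Finset (Orb (FermionTorus 2 L))) (Finset (Orb (FermionTorus 2 L))) ℂ)).re =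
        (Matrix.gibbsState β (T₀ - ((μs - σ : ℝ) : ℂ) • (Matrix.diagonal fun s : Finset (Orb (FermionTorus 2 L)) => (((s ∩ SA).card : ℕ) : ℂ)) - ((μs + σ : ℝ) : ℂ) • (Matrix.diagonal fun s : Finset (Orb (FermionTorus 2 L)) => (((s ∩ SB).card : ℕ) : ℂ)) - (μs : ℂ) • (Matrix.diagonal fun s : Finset (Orb (FermionTorus 2 L)) => (((s ∩ SR).card : ℕ) : ℂ))) (Matrix.diagonal fun s : Finset (Orb (FermionTorus 2 L)) => (((s ∩ SA).card : ℕ) : ℂ))).re + (Matrix.gibbsState β (T₀ - ((μs - σ : ℝ) : ℂ) • (Matrix.diagonal fun s : Finset (Orb (FermionTorus 2 L)) => (((s ∩ SA).card : ℕ) : ℂ)) - ((μs + σ : ℝ) : ℂ) • (Matrix.diagonal fun s : Finset (Orb (FermionTorus 2 L)) => (((s ∩ SB).card : ℕ) : ℂ)) - (μs : ℂ) • (Matrix.diagonal fun s : Finset (Orb (FermionTorus 2 L)) => (((s ∩ SR).card : ℕ) : ℂ))) (Matrix.diagonal fun s : Finset (Orb (FermionTorus 2 L)) => (((s ∩ SB).card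 : ℕ) : ℂ))).re +
          (Matrix.gibbsState β (T₀ - ((μs - σ : ℝ) : ℂ) • (Matrix.diagonal fun s : Finset (Orb (FermionTorus 2 L)) => (((s ∩ SA).card : ℕ) : ℂ)) - ((μs + σ : ℝ) : ℂ) • (Matrix.diagonal fun s : Finset (Orb (FermionTorus 2 L)) => (((s ∩ SB).card : ℕ) : ℂ)) - (μs : ℂ) • (Matrix.diagonal fun s : Finset (Orb (FermionTorus 2 L)) => (((s ∩ SR).card : ℕ) : ℂ))) (Matrix.diagonal fun s : Finset (Orb (FermionTorus 2 L)) => (((s ∩ SR).card : ℕ) : ℂ))).re := by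
      rw [hN, map_add, map_add, Complex.add_re, Complex.add_re]
    rw [hmA, hmB] at hX
    obtain ⟨hρ0, hρ1⟩ := tsb_re_gibbsState_numberDiag_bounds hHerm β SR
    have hρ : (Matrix.gibbsState β (T₀ - ((μs - σ : ℝ) : ℂ) • (Matrix.diagonal fun s : Finset (Orb (FermionTorus 2 L)) => (((s ∩ SA).card : ℕ) : ℂ)) - ((μs + σ : ℝ) : ℂ) • (Matrix.diagonal fun s : Finset (Orb (FermionTorus 2 L)) => (((s ∩ SB).card : ℕ) : ℂ)) - (μs : ℂ) • (Matrix.diagonal fun s : Finset (Orb (FermionTorus 2 L)) => (((s ∩ SR).card : ℕ) : ℂ))) (Matrix.diagonal fun s : Finset (Orb (FermionTorus 2 L)) => (((s ∩ SR).card : ℕ) : ℂ))).re ≤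
        6 * L * M := hρ1.trans hSR
    have hmean := tsb_mean_arith hLpos.le hMpos.le hσ0 hr0.le hδ0 hδ1 hKr0 hKM hLK hnA0 hnB2 hnA hnB hNL1 hNL2 hρ0 hρ htune hX
    have hP : 2 * (M : ℝ) ^ 2 + 8 * L * M + 2 ≤ 12 * L * M := by nlinarith [hMLr, hMr1, hLr1]
    have hfin := tsb_fluct_final (C₂ := C * (1 + Real.sqrt (β * |h₀|))) hLr1 hε'0 hε'1 hV hmean (by ring)
      (by positivity) hrσ (by positivity) hP hthr₃
    calc _ ≤ ε' * (L : ℝ) ^ 4 := hfin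
      _ ≤ ε * (L : ℝ) ^ 4 := by gcongr

end

end Summit.HubbardSuperconductivity.HubbardSuperconductivity.Theorems.TwSeededEnsembleEquivalenceR.ColdFloorLine
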